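import Literature.Analysis.FluidPDE.CarlemanCommutator
import Literature.Analysis.FluidPDE.CarlemanFirstWeight
import HarnessLib

/-!
# Conjugation `v = e^φ u` for a general Carleman weight (Seregin 2014, (A.1.2), (A.1.5), (A.1.8), (A.1.11))

Analysis/FluidPDE file in the backward-uniqueness track of the decomposition of **ns.S08**
`Literature.Analysis.FluidPDE.ess_endpoint` (ESS 2003, Thm. 5.1 ⇐ the two Carleman inequalities
of §6 = Seregin 2014, App. A.1, Props. 1.2–1.3). `FluidPDE/CarlemanCommutator` provides, for a
weight `φ ∈ C^∞(Ω)` on an open `Ω ⊆ ℝ × E`, the operators `S` (`opSW`) and `A` (`opAW`) and the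
commutator identity (A.1.6). This file supplies the remaining weight-independent steps of the
`L₂` method, once and for all:

* `expConj φ u = e^φ u` and its derivatives on `Ω` (`fderiv_expConj_apply`, `dt_expConj`,
  `dx_expConj`, `dx_dx_expConj`, `lap_expConj`);
* **(A.1.2)** `opSW_add_opAW_expConj`: `S v + A v = tLv = t e^φ (∂ₜu + Δu)` for `v = e^φ u`
  (all lower-order terms cancel), valid at every point when `tsupport u ⊆ Ω`;
* **(A.1.5)** `two_mul_integral_inner_opSW_opAW_le`: `2∫⟪Sv, Av⟫ ≤ ∫ |Sv + Av|²`;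
* **(A.1.8)/(A.1.24)** `integral_fst_mul_gradSq_eq`:
  `∫ t|∇v|² = -½∫|v|² - ∫ ⟪v, Sv + Av⟫ + ∫ t q |v|²`, `q = |∇φ|² - ∂ₜφ`;
* **(A.1.11)** `exp_sq_mul_gradSq_le_of_open`: `e^{2φ}|∇u|² ≤ 2|∇v|² + 2|∇φ|²|v|²`.

All statements are proved.

## References

* G. Seregin, *Lecture notes on regularity theory for the Navier–Stokes equations*, World
  Scientific 2014, Appendix A.1, (A.1.2), (A.1.5), (A.1.8), (A.1.11), (A.1.24).
* L. Escauriaza, G. Seregin, V. Šverák, *`L_{3,∞}`-solutions of Navier–Stokes equations and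
  backward uniqueness*, Russ. Math. Surveys 58:2 (2003), §6.
-/

noncomputable section

open MeasureTheory Set Function Filter Topology
open scoped InnerProductSpace RealInnerProductSpace

namespace Literature.Analysis.FluidPDE

namespace Carleman

section Conjugate

variable {E : Type*} [NormedAddCommGroup E] [InnerProductSpace ℝ E] [FiniteDimensional ℝ E]
  [MeasurableSpace E] [BorelSpace E]
variable {F : Type*} [NormedAddCommGroup F] [InnerProductSpace ℝ F]

/-- The conjugated field `v = e^φ u`. [cite: Seregin2014, App. A.1 (A.1.2)] -/
def expConj (φ : ℝ × E → ℝ) (U : ℝ × E → F) : ℝ × E → F := fun y => Real.exp (φ y) • U y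

omit [NormedAddCommGroup E] [InnerProductSpace ℝ E] [FiniteDimensional ℝ E] [MeasurableSpace E]
  [BorelSpace E] in
/-- Unfolding `e^φ u`. [folklore] -/
@[simp] theorem expConj_apply (φ : ℝ × E → ℝ) (U : ℝ × E → F) (y : ℝ × E) :
    expConj φ U y = Real.exp (φ y) • U y := rfl

variable {Ω : Set (ℝ × E)} {δ : ℝ} {φ : ℝ × E → ℝ} {U : ℝ × E → F}
variable (hΩ : IsOpen Ω) (hφ : ContDiffOn ℝ (⊤ : ℕ∞) φ Ω) (hU : ContDiff ℝ (⊤ : ℕ∞) U)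
  (hUc : HasCompactSupport U) (hUΩ : tsupport U ⊆ Ω)
include hΩ hφ hU hUc hUΩ

/-! #### Smoothness and support of `e^φ u` -/

omit [InnerProductSpace ℝ E] [FiniteDimensional ℝ E] [MeasurableSpace E] [BorelSpace E] hΩ hφ hU hUc hUΩ in
/-- `e^φ u` is supported in `tsupport u`. [folklore] -/
theorem tsupport_expConj_subset : tsupport (expConj φ U) ⊆ tsupport U :=
  closure_minimal (fun z hz => by
    by_contra h
    exact hz (by simp [image_eq_zero_of_notMem_tsupport h])) (isClosed_tsupport U)

omit [InnerProductSpace ℝ E] [FiniteDimensional ℝ E] [MeasurableSpace E] [BorelSpace E] hΩ hφ hU hUΩ in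
/-- `e^φ u` is compactly supported. [folklore] -/
theorem hasCompactSupport_expConj : HasCompactSupport (expConj φ U) :=
  hUc.mono' ((subset_tsupport _).trans tsupport_expConj_subset)

omit [FiniteDimensional ℝ E] [MeasurableSpace E] [BorelSpace E] hUc in
/-- `e^φ u ∈ C^∞` (smooth on `Ω`, zero off `tsupport u ⊆ Ω`). [folklore] -/
theorem contDiff_expConj : ContDiff ℝ (⊤ : ℕ∞) (expConj φ U) :=
  contDiff_of_contDiffOn_of_eq_zero hΩ (isClosed_tsupport U) hUΩ
    ((hφ.exp).smul hU.contDiffOn) fun z hz => by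
      show Real.exp (φ z) • U z = 0
      rw [image_eq_zero_of_notMem_tsupport hz, smul_zero]

/-! #### First derivatives -/

omit [FiniteDimensional ℝ E] [MeasurableSpace E] [BorelSpace E] hUc hUΩ in
/-- `D(e^φ u)(z) w = e^φ (Du(z) w + Dφ(z) w · u(z))` on `Ω`. [cite: Seregin2014, App. A.1 (A.1.11)] -/
theorem fderiv_expConj_apply {z : ℝ × E} (hz : z ∈ Ω) (w : ℝ × E) :
    fderiv ℝ (expConj φ U) z w = Real.exp (φ z) • (fderiv ℝ U z w + fderiv ℝ φ z w • U z) :=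
  fderiv_exp_smul_apply ((hφ.differentiableOn (by simp)).differentiableAt (hΩ.mem_nhds hz))
    (hU.differentiable (by simp) z) w

omit [FiniteDimensional ℝ E] [MeasurableSpace E] [BorelSpace E] hUc hUΩ in
/-- `∂ₜ(e^φ u) = e^φ (∂ₜu + ∂ₜφ u)` on `Ω`. [cite: Seregin2014, App. A.1 (A.1.2)] -/
theorem dt_expConj {z : ℝ × E} (hz : z ∈ Ω) :
    dt (expConj φ U) z = Real.exp (φ z) • (dt U z + dt φ z • U z) := by
  rw [dt_apply, fderiv_expConj_apply hΩ hφ hU hz]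
  rfl

omit [FiniteDimensional ℝ E] [MeasurableSpace E] [BorelSpace E] hUc hUΩ in
/-- `∂ₑ(e^φ u) = e^φ (∂ₑu + ∂ₑφ u)` on `Ω`. [cite: Seregin2014, App. A.1 (A.1.11)] -/
theorem dx_expConj {z : ℝ × E} (hz : z ∈ Ω) (e : E) :
    dx e (expConj φ U) z = Real.exp (φ z) • (dx e U z + dx e φ z • U z) := by
  rw [dx_apply, fderiv_expConj_apply hΩ hφ hU hz]
  rfl

omit [MeasurableSpace E] [BorelSpace E] hUc hUΩ in
/-- `D(e^φ u)(0, ∇φ) = e^φ (Du(0, ∇φ) + |∇φ|² u)` on `Ω`. [cite: Seregin2014, App. A.1 (A.1.2)] -/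
theorem fderiv_expConj_apply_gradX {z : ℝ × E} (hz : z ∈ Ω) :
    fderiv ℝ (expConj φ U) z (0, gradX φ z) =
      Real.exp (φ z) • (fderiv ℝ U z (0, gradX φ z) + ‖gradX φ z‖ ^ 2 • U z) := by
  rw [fderiv_expConj_apply hΩ hφ hU hz, ← inner_gradX, real_inner_self_eq_norm_sq]

/-! #### Second derivatives and the Laplacian -/

omit [FiniteDimensional ℝ E] [MeasurableSpace E] [BorelSpace E] hUc hUΩ in
/-- **`∂ₑ∂ₑ(e^φ u) = e^φ (∂ₑ∂ₑu + 2∂ₑφ ∂ₑu + (∂ₑ∂ₑφ + (∂ₑφ)²) u)`** on `Ω`. [cite: Seregin2014, App. A.1 (A.1.2)] -/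
theorem dx_dx_expConj {z : ℝ × E} (hz : z ∈ Ω) (e : E) :
    dx e (dx e (expConj φ U)) z =
      Real.exp (φ z) • (dx e (dx e U) z + (2 * dx e φ z) • dx e U z +
        (dx e (dx e φ) z + dx e φ z ^ 2) • U z) := by
  -- near `z`, `∂ₑ v = e^φ K` with `K = ∂ₑu + ∂ₑφ u`
  set K : ℝ × E → F := fun y => dx e U y + dx e φ y • U y with hK
  have hev : dx e (expConj φ U) =ᶠ[𝓝 z] fun y => Real.exp (φ y) • K y := by
    filter_upwards [hΩ.mem_nhds hz] with y hy
    exact dx_expConj hΩ hφ hU hy e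
  rw [dx_apply, hev.fderiv_eq]
  have hUd : DifferentiableAt ℝ U z := hU.differentiable (by simp) z
  have hdxU : DifferentiableAt ℝ (dx e U) z := (contDiff_dx hU e).differentiable (by simp) z
  have hφd : DifferentiableAt ℝ φ z := (hφ.differentiableOn (by simp)).differentiableAt (hΩ.mem_nhds hz)
  have hdxφ : DifferentiableAt ℝ (dx e φ) z :=
    ((contDiffOn_dx hΩ hφ e).differentiableOn (by simp)).differentiableAt (hΩ.mem_nhds hz)
  have hKd : HasFDerivAt K (fderiv ℝ (dx e U) z +
      (dx e φ z • fderiv ℝ U z + (fderiv ℝ (dx e φ) z).smulRight (U z))) z :=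
    hdxU.hasFDerivAt.add (hdxφ.hasFDerivAt.smul hUd.hasFDerivAt)
  have hKv : fderiv ℝ K z (0, e) = dx e (dx e U) z + (dx e φ z • dx e U z + dx e (dx e φ) z • U z) := by
    rw [hKd.fderiv]
    simp only [_root_.add_apply, _root_.smul_apply, ContinuousLinearMap.smulRight_apply, dx_apply]
  rw [fderiv_exp_smul_apply hφd hKd.differentiableAt, hKv]
  simp only [hK, ← dx_apply]
  match_scalars <;> ring

omit [MeasurableSpace E] [BorelSpace E] hUc hUΩ in
/-- **The conjugated Laplacian**: `Δ(e^φ u) = e^φ (Δu + 2 Du(0,∇φ) + (Δφ + |∇φ|²) u)` on `Ω`. [cite: Seregin2014, App. A.1 (A.1.2)] -/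
theorem lap_expConj {z : ℝ × E} (hz : z ∈ Ω) :
    lap (expConj φ U) z =
      Real.exp (φ z) • (lap U z + (2 : ℝ) • fderiv ℝ U z (0, gradX φ z) +
        (lap φ z + ‖gradX φ z‖ ^ 2) • U z) := by
  set b := stdOrthonormalBasis ℝ E with hb
  rw [lap, Finset.sum_congr rfl fun i _ => dx_dx_expConj hΩ hφ hU hz (b i), ← Finset.smul_sum]
  congr 1
  simp only [Finset.sum_add_distrib]
  have e1 : ∑ i, dx (b i) (dx (b i) U) z = lap U z := rfl
  have e2 : ∑ i, (2 * dx (b i) φ z) • dx (b i) U z = (2 : ℝ) • fderiv ℝ U z (0, gradX φ z) := by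
    rw [fderiv_apply_gradX, Finset.smul_sum]
    refine Finset.sum_congr rfl fun i _ => ?_
    rw [smul_smul]
  have e3 : ∑ i, (dx (b i) (dx (b i) φ) z + dx (b i) φ z ^ 2) • U z =
      (lap φ z + ‖gradX φ z‖ ^ 2) • U z := by
    rw [← Finset.sum_smul, Finset.sum_add_distrib, norm_gradX_sq, gradSq]
    have h2 : ∑ i, dx (b i) φ z ^ 2 = ∑ i, ‖dx (b i) φ z‖ ^ 2 :=
      Finset.sum_congr rfl fun i _ => by rw [Real.norm_eq_abs, sq_abs]
    rw [h2]
    rfl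
  rw [e1, e2, e3]

/-! #### (A.1.2): `S v + A v = t e^φ (∂ₜu + Δu)` -/

omit [MeasurableSpace E] [BorelSpace E] hUc hUΩ in
/-- **The conjugated operator on `Ω`** (Seregin 2014, (A.1.2): `tL = S + A`): for `v = e^φ u`,
`S v + A v = t e^φ (∂ₜu + Δu)` — the zeroth- and first-order terms of
`L = ∂ₜ + Δ - 2D(·)(0,∇φ) - Δφ + (|∇φ|² - ∂ₜφ)` cancel exactly against the derivatives of `e^φ`. [cite: Seregin2014, App. A.1 (A.1.2)–(A.1.4)] -/
theorem opSW_add_opAW_expConj_of_mem {z : ℝ × E} (hz : z ∈ Ω) :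
    opSW φ (expConj φ U) z + opAW φ (expConj φ U) z =
      (z.1 * Real.exp (φ z)) • (dt U z + lap U z) := by
  simp only [opSW, opAW, qW, lap_expConj hΩ hφ hU hz, dt_expConj hΩ hφ hU hz,
    fderiv_expConj_apply_gradX hΩ hφ hU hz, expConj_apply]
  match_scalars <;> ring

omit [MeasurableSpace E] [BorelSpace E] hUc in
/-- **(A.1.2) at every point** when `tsupport u ⊆ Ω` (off `Ω` both sides vanish). [cite: Seregin2014, App. A.1 (A.1.2)] -/
theorem opSW_add_opAW_expConj (z : ℝ × E) :
    opSW φ (expConj φ U) z + opAW φ (expConj φ U) z =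
      (z.1 * Real.exp (φ z)) • (dt U z + lap U z) := by
  by_cases hz : z ∈ Ω
  · exact opSW_add_opAW_expConj_of_mem hΩ hφ hU hz
  · have hzU : z ∉ tsupport U := fun h => hz (hUΩ h)
    have hzV : z ∉ tsupport (expConj φ U) := fun h => hzU (tsupport_expConj_subset h)
    have hU0 : U z = 0 := image_eq_zero_of_notMem_tsupport hzU
    have hdV : fderiv ℝ (expConj φ U) z = 0 := fderiv_of_notMem_tsupport (𝕜 := ℝ) hzV
    have hdU : fderiv ℝ U z = 0 := fderiv_of_notMem_tsupport (𝕜 := ℝ) hzU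
    have hlapV : lap (expConj φ U) z = 0 :=
      image_eq_zero_of_notMem_tsupport fun h => hzV (tsupport_lap_subset _ h)
    have hlapU : lap U z = 0 := image_eq_zero_of_notMem_tsupport fun h => hzU (tsupport_lap_subset _ h)
    simp [opSW, opAW, hU0, hdV, hlapV, hlapU, hdU, dt_apply]

/-! #### Continuity and integrability of `S v`, `A v` -/

variable {V : ℝ × E → F} (hV : ContDiff ℝ (⊤ : ℕ∞) V) (hVc : HasCompactSupport V)
  (hVΩ : tsupport V ⊆ Ω)
include hV hVc hVΩ

omit [MeasurableSpace E] [BorelSpace E] hU hUc hUΩ hVc in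
/-- `S v` is continuous (the weight `q` is continuous on `Ω ⊇ tsupport v`). [folklore] -/
theorem continuous_opSW : Continuous (opSW φ V) := by
  have h1 : Continuous fun z => qW φ z • V z :=
    continuous_smul_of_tsupport_subset hΩ (contDiffOn_qW hΩ hφ).continuousOn hV.continuous hVΩ
  unfold opSW
  exact ((continuous_fst.smul ((contDiff_lap hV).continuous.add h1)).sub
    (continuous_const.smul hV.continuous))

omit [MeasurableSpace E] [BorelSpace E] hU hUc hUΩ hVc in
/-- `A v` is continuous. [folklore] -/
theorem continuous_opAW : Continuous (opAW φ V) := by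
  have h1 : Continuous fun z => (z.1 * lap φ z) • V z :=
    continuous_smul_of_tsupport_subset hΩ
      (continuous_fst.continuousOn.mul (contDiffOn_lap_of_open hΩ hφ).continuousOn) hV.continuous hVΩ
  have h2 : Continuous fun z => fderiv ℝ V z (0, gradX φ z) :=
    (contDiff_fderiv_apply_gradX hΩ hφ hV hVΩ).continuous
  unfold opAW
  exact (((continuous_fst.smul (contDiff_dt hV).continuous).add
    (continuous_const.smul hV.continuous)).sub ((continuous_const.mul continuous_fst).smul h2)).sub h1

omit [MeasurableSpace E] [BorelSpace E] hΩ hφ hU hUc hUΩ hV hVc hVΩ in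
/-- `S v` is supported in `tsupport v`. [folklore] -/
theorem tsupport_opSW_subset : tsupport (opSW φ V) ⊆ tsupport V := by
  refine closure_minimal (fun z hz => ?_) (isClosed_tsupport V)
  by_contra h
  have hV0 : V z = 0 := image_eq_zero_of_notMem_tsupport h
  have hl : lap V z = 0 := image_eq_zero_of_notMem_tsupport fun h' => h (tsupport_lap_subset _ h')
  exact hz (by simp [opSW, hV0, hl])

omit [MeasurableSpace E] [BorelSpace E] hΩ hφ hU hUc hUΩ hV hVc hVΩ in
/-- `A v` is supported in `tsupport v`. [folklore] -/
theorem tsupport_opAW_subset : tsupport (opAW φ V) ⊆ tsupport V := by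
  refine closure_minimal (fun z hz => ?_) (isClosed_tsupport V)
  by_contra h
  have hV0 : V z = 0 := image_eq_zero_of_notMem_tsupport h
  have hd : fderiv ℝ V z = 0 := fderiv_of_notMem_tsupport (𝕜 := ℝ) h
  exact hz (by simp [opAW, hV0, hd, dt_apply])

omit hU hUc hUΩ in
/-- **(A.1.5), the inequality**: `2 ∫ ⟪S v, A v⟫ ≤ ∫ |S v + A v|²`
(`|Sv + Av|² = |Sv|² + |Av|² + 2⟪Sv, Av⟫` pointwise). [cite: Seregin2014, App. A.1 (A.1.5)] -/
theorem two_mul_integral_inner_opSW_opAW_le :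
    2 * ∫ z, ⟪opSW φ V z, opAW φ V z⟫ ≤ ∫ z, ‖opSW φ V z + opAW φ V z‖ ^ 2 := by
  have cS := continuous_opSW hΩ hφ hV hVΩ
  have cA := continuous_opAW hΩ hφ hV hVΩ
  have hSc : HasCompactSupport (opSW φ V) := hVc.mono' ((subset_tsupport _).trans tsupport_opSW_subset)
  have hAc : HasCompactSupport (opAW φ V) := hVc.mono' ((subset_tsupport _).trans tsupport_opAW_subset)
  have iSA : Integrable fun z => ⟪opSW φ V z, opAW φ V z⟫ :=
    (continuous_inner.comp (cS.prodMk cA)).integrable_of_hasCompactSupport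
      (hAc.mono fun z hz => by
        contrapose! hz
        simp [notMem_support.1 hz])
  have iS : Integrable fun z => ‖opSW φ V z‖ ^ 2 :=
    (cS.norm.pow 2).integrable_of_hasCompactSupport
      (hSc.mono fun z hz => by
        contrapose! hz
        simp [notMem_support.1 hz])
  have iA : Integrable fun z => ‖opAW φ V z‖ ^ 2 :=
    (cA.norm.pow 2).integrable_of_hasCompactSupport
      (hAc.mono fun z hz => by
        contrapose! hz
        simp [notMem_support.1 hz])
  have hexp : ∀ z, ‖opSW φ V z + opAW φ V z‖ ^ 2 =
      ‖opSW φ V z‖ ^ 2 + ‖opAW φ V z‖ ^ 2 + 2 * ⟪opSW φ V z, opAW φ V z⟫ := fun z => by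
    rw [norm_add_sq_real]; ring
  have i12 : Integrable (fun z => ‖opSW φ V z‖ ^ 2 + ‖opAW φ V z‖ ^ 2) := iS.add iA
  rw [integral_congr_ae (Eventually.of_forall hexp), integral_add i12 (iSA.const_mul 2),
    integral_add iS iA, integral_const_mul]
  have h1 : 0 ≤ ∫ z, ‖opSW φ V z‖ ^ 2 := integral_nonneg fun z => sq_nonneg _
  have h2 : 0 ≤ ∫ z, ‖opAW φ V z‖ ^ 2 := integral_nonneg fun z => sq_nonneg _
  linarith

/-! #### (A.1.8)/(A.1.24): `∫ t|∇v|²` through `⟪v, tLv⟩` -/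

omit hU hUc hUΩ in
/-- **(A.1.24)** (the analogue of (A.1.8)–(A.1.9) for a general weight): for `v` smooth,
compactly supported in `Ω ∩ {t ≥ δ}`,
`∫ t|∇v|² = -½ ∫ |v|² - ∫ ⟪v, S v + A v⟫ + ∫ t q |v|²`, `q = |∇φ|² - ∂ₜφ`
(Green `∫ t⟪v,Δv⟩ = -∫ t|∇v|²`, `∫ t⟪v,∂ₜv⟩ = -½∫|v|²`, and the transport identity
`-2∫ t⟪v, Dv(0,∇φ)⟩ = ∫ tΔφ|v|²`, which cancels the `-tΔφ|v|²` term of `A`). [cite: Seregin2014, App. A.1 (A.1.24)] -/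
theorem integral_fst_mul_gradSq_eq (hδ : 0 < δ) (hVδ : tsupport V ⊆ {z | δ ≤ z.1}) :
    ∫ z, z.1 * gradSq V z =
      -(1 / 2) * (∫ z, ‖V z‖ ^ 2) - (∫ z, ⟪V z, opSW φ V z + opAW φ V z⟫) +
        ∫ z, z.1 * qW φ z * ‖V z‖ ^ 2 := by
  have hV1 : ContDiff ℝ 1 V := hV.of_le (by exact_mod_cast le_top)
  have ct : ContinuousOn (fun z : ℝ × E => z.1) Ω := continuous_fst.continuousOn
  have cq : ContinuousOn (qW φ) Ω := (contDiffOn_qW hΩ hφ).continuousOn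
  have clapφ : ContinuousOn (lap φ) Ω := (contDiffOn_lap_of_open hΩ hφ).continuousOn
  have cX : Continuous fun z => fderiv ℝ V z (0, gradX φ z) :=
    (contDiff_fderiv_apply_gradX hΩ hφ hV hVΩ).continuous
  -- pointwise expansion of `⟪v, Sv + Av⟫`
  have hexp : ∀ z, ⟪V z, opSW φ V z + opAW φ V z⟫ =
      z.1 * ⟪V z, lap V z⟫ + z.1 * qW φ z * ‖V z‖ ^ 2 + z.1 * ⟪V z, dt V z⟫ +
        (-2) * (z.1 * ⟪V z, fderiv ℝ V z (0, gradX φ z)⟫) + (-(z.1 * lap φ z * ‖V z‖ ^ 2)) := by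
    intro z
    simp only [opSW, opAW, smul_add, inner_add_right, inner_sub_right, real_inner_smul_right]
    simp only [real_inner_self_eq_norm_sq]
    ring
  have i1 : Integrable fun z : ℝ × E => z.1 * ⟪V z, lap V z⟫ :=
    integrable_mul_inner_of_open hΩ hVΩ ct hV.continuous.continuousOn
      (contDiff_lap hV).continuous.continuousOn hVc subset_rfl
  have i2 : Integrable fun z : ℝ × E => z.1 * qW φ z * ‖V z‖ ^ 2 :=
    integrable_mul_norm_sq_of_open hΩ hV hVc hVΩ (ct.mul cq)
  have i3 : Integrable fun z : ℝ × E => z.1 * ⟪V z, dt V z⟫ :=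
    integrable_mul_inner_of_open hΩ hVΩ ct hV.continuous.continuousOn
      (contDiff_dt hV).continuous.continuousOn hVc subset_rfl
  have i4 : Integrable fun z : ℝ × E => (-2) * (z.1 * ⟪V z, fderiv ℝ V z (0, gradX φ z)⟫) :=
    (integrable_mul_inner_of_open hΩ hVΩ ct hV.continuous.continuousOn cX.continuousOn hVc
      subset_rfl).const_mul _
  have i5 : Integrable fun z : ℝ × E => -(z.1 * lap φ z * ‖V z‖ ^ 2) :=
    (integrable_mul_norm_sq_of_open hΩ hV hVc hVΩ (ct.mul clapφ)).neg
  -- evaluations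
  have E1 : ∫ z : ℝ × E, z.1 * ⟪V z, lap V z⟫ = -∫ z : ℝ × E, z.1 * gradSq V z :=
    integral_mul_inner_lap_self hδ hV hVc hVδ (g := fun t => t) contDiff_id
  have E3 : ∫ z : ℝ × E, z.1 * ⟪V z, dt V z⟫ = -(1 / 2) * ∫ z : ℝ × E, ‖V z‖ ^ 2 := by
    have h := two_mul_integral_mul_inner_dt_self hδ (g := fun t => t) contDiff_id hV1 hVc hVδ
    simp only [deriv_id'', one_mul] at h
    linarith [h]
  have E4 : ∫ z : ℝ × E, (-2) * (z.1 * ⟪V z, fderiv ℝ V z (0, gradX φ z)⟫) =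
      ∫ z : ℝ × E, z.1 * lap φ z * ‖V z‖ ^ 2 := by
    have h := two_mul_integral_fst_mul_inner_fderiv_gradX hΩ hV hVc hVΩ hφ
    have e : ∫ z : ℝ × E, z.1 * ⟪V z, fderiv ℝ V z (0, gradX φ z)⟫ =
        ∫ z : ℝ × E, z.1 * ⟪fderiv ℝ V z (0, gradX φ z), V z⟫ :=
      integral_congr_ae (Eventually.of_forall fun z => by
        show z.1 * ⟪V z, fderiv ℝ V z (0, gradX φ z)⟫ = z.1 * ⟪fderiv ℝ V z (0, gradX φ z), V z⟫
        rw [real_inner_comm])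
    rw [integral_const_mul, e]
    linarith [h]
  have E5 : ∫ z : ℝ × E, -(z.1 * lap φ z * ‖V z‖ ^ 2) = -∫ z : ℝ × E, z.1 * lap φ z * ‖V z‖ ^ 2 :=
    integral_neg _
  have s12 : Integrable (fun z : ℝ × E => z.1 * ⟪V z, lap V z⟫ + z.1 * qW φ z * ‖V z‖ ^ 2) := i1.add i2
  have s123 : Integrable (fun z : ℝ × E => z.1 * ⟪V z, lap V z⟫ + z.1 * qW φ z * ‖V z‖ ^ 2 +
      z.1 * ⟪V z, dt V z⟫) := s12.add i3
  have s1234 : Integrable (fun z : ℝ × E => z.1 * ⟪V z, lap V z⟫ + z.1 * qW φ z * ‖V z‖ ^ 2 +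
      z.1 * ⟪V z, dt V z⟫ + (-2) * (z.1 * ⟪V z, fderiv ℝ V z (0, gradX φ z)⟫)) := s123.add i4
  have hsplit : ∫ z, ⟪V z, opSW φ V z + opAW φ V z⟫ =
      (∫ z : ℝ × E, z.1 * ⟪V z, lap V z⟫) + (∫ z : ℝ × E, z.1 * qW φ z * ‖V z‖ ^ 2) +
        (∫ z : ℝ × E, z.1 * ⟪V z, dt V z⟫) +
        (∫ z : ℝ × E, (-2) * (z.1 * ⟪V z, fderiv ℝ V z (0, gradX φ z)⟫)) +
        ∫ z : ℝ × E, -(z.1 * lap φ z * ‖V z‖ ^ 2) := by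
    rw [integral_congr_ae (Eventually.of_forall hexp), integral_add s1234 i5, integral_add s123 i4,
      integral_add s12 i3, integral_add i1 i2]
  rw [hsplit, E1, E3, E4, E5]
  ring

/-! #### (A.1.11): the gradient of `u` through `v` -/

omit [MeasurableSpace E] [BorelSpace E] hUc hUΩ hV hVc hVΩ in
/-- **(A.1.11)**: `e^{2φ} |∇u|² ≤ 2|∇v|² + 2|∇φ|² |v|²` on `Ω`, `v = e^φ u`
(`e^φ ∂ᵢu = ∂ᵢv - ∂ᵢφ v` and `|a - b|² ≤ 2|a|² + 2|b|²`, summed over the frame). [cite: Seregin2014, App. A.1 (A.1.11)] -/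
theorem exp_sq_mul_gradSq_le_of_mem {z : ℝ × E} (hz : z ∈ Ω) :
    Real.exp (φ z) ^ 2 * gradSq U z ≤
      2 * gradSq (expConj φ U) z + 2 * ‖gradX φ z‖ ^ 2 * ‖expConj φ U z‖ ^ 2 := by
  set b := stdOrthonormalBasis ℝ E with hb
  have step : ∀ i, Real.exp (φ z) ^ 2 * ‖dx (b i) U z‖ ^ 2 ≤
      2 * ‖dx (b i) (expConj φ U) z‖ ^ 2 + 2 * (dx (b i) φ z ^ 2 * ‖expConj φ U z‖ ^ 2) := by
    intro i
    have hrel : Real.exp (φ z) • dx (b i) U z =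
        dx (b i) (expConj φ U) z - dx (b i) φ z • expConj φ U z := by
      rw [dx_expConj hΩ hφ hU hz, expConj_apply, smul_add, smul_smul, smul_smul, mul_comm,
        add_sub_cancel_right]
    have hn : Real.exp (φ z) ^ 2 * ‖dx (b i) U z‖ ^ 2 = ‖Real.exp (φ z) • dx (b i) U z‖ ^ 2 := by
      rw [norm_smul, Real.norm_eq_abs, abs_of_pos (Real.exp_pos _)]; ring
    have hm : dx (b i) φ z ^ 2 * ‖expConj φ U z‖ ^ 2 = ‖dx (b i) φ z • expConj φ U z‖ ^ 2 := by
      rw [norm_smul, Real.norm_eq_abs, mul_pow, sq_abs]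
    rw [hn, hrel, hm]
    nlinarith [norm_sub_sq_real (dx (b i) (expConj φ U) z) (dx (b i) φ z • expConj φ U z),
      norm_add_sq_real (dx (b i) (expConj φ U) z) (dx (b i) φ z • expConj φ U z),
      sq_nonneg ‖dx (b i) (expConj φ U) z + dx (b i) φ z • expConj φ U z‖]
  calc Real.exp (φ z) ^ 2 * gradSq U z = ∑ i, Real.exp (φ z) ^ 2 * ‖dx (b i) U z‖ ^ 2 := by
        rw [gradSq, Finset.mul_sum]
    _ ≤ ∑ i, (2 * ‖dx (b i) (expConj φ U) z‖ ^ 2 + 2 * (dx (b i) φ z ^ 2 * ‖expConj φ U z‖ ^ 2)) :=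
        Finset.sum_le_sum fun i _ => step i
    _ = 2 * gradSq (expConj φ U) z + 2 * ‖gradX φ z‖ ^ 2 * ‖expConj φ U z‖ ^ 2 := by
        rw [Finset.sum_add_distrib, gradSq, Finset.mul_sum, norm_gradX_sq, gradSq, Finset.mul_sum,
          Finset.sum_mul]
        congr 1
        refine Finset.sum_congr rfl fun i _ => ?_
        rw [Real.norm_eq_abs, sq_abs]
        ring

end Conjugate

end Carleman

end Literature.Analysis.FluidPDE
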